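import Literature.NumberTheory.NumberFields.EisensteinFieldIntegers
import Mathlib.GroupTheory.Perm.Cycle.Type
import Mathlib.Algebra.QuadraticAlgebra.NormDeterminant
import HarnessLib

/-!
# The splitting of rational primes in `𝓞 ℚ(ζ₃)`: inert `p ≡ 2 (3)`, split `p ≡ 1 (3)`, ramified `3`

Topic `NumberTheory/NumberFields`; namespace `Literature.NumberTheory.NumberFields.K3`; sequel to
`EisensteinFieldIntegers` (`K3 = QuadraticAlgebra ℚ (−1) (−1)`, `mkInt a b = a + bζ`, the norm form
`a² − ab + b²`, PID, units `±ζ^i`). Everything is PROVED; no definition, no named fact. Filed in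
support of the named fact `murty_petersson_newform_lower_bound` (the Euler product of the Hecke
`L`-functions of `ℚ(ζ₃)` over the RATIONAL primes needs the decomposition of `(p)`), and of general use
(Ireland–Rosen Prop. 9.1.4, "the primes of `ℤ[ω]`").

* `algebraNorm_mkInt`, `absNorm_span_mkInt` — `N(a + bζ) = a² − ab + b²` for Mathlib's `Algebra.norm ℤ`
  and `Ideal.absNorm` (`QuadraticAlgebra.det_toLinearMap_eq_norm`); `mkInt_mul_conj`
  (`(a + bζ)((a−b) − bζ) = N`), `norm_eq_one_of_isUnit`, `prime_mkInt_of_norm_eq_prime`;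
* INERT: `norm_int_emod_three_ne_two` (`4N = (2a−b)² + 3b²`), **`prime_natCast_of_mod_three_eq_two`**
  (`p ≡ 2 (3)` is a prime element), `asIdeal_eq_of_mod_three_eq_two` (the only prime above `p` is `(p)`);
* SPLIT: `exists_dvd_sq_add_self_add_one` (a cube root of unity mod `p ≡ 1 (3)`, Cauchy in `(ℤ/p)ˣ`),
  `not_prime_natCast_of_mod_three_eq_one` (`p ∣ (x−ζ)(x−ζ̄)`, `p ∤ x − ζ`),
  **`exists_norm_eq_of_mod_three_eq_one`** (`p = a² − ab + b²`: an irreducible factor of `p` has norm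
  `p`), **`not_associated_conj`** (`ϖ̄ ≁ ϖ`: case analysis over the six units, else `p` would be a
  square or `3·`square), `span_natCast_eq_mul_conj` (`(p) = (ϖ)(ϖ̄)`), `span_ne_span_conj`,
  `asIdeal_eq_or_of_norm_eq` (a prime above `p` is `(ϖ)` or `(ϖ̄)`), `exists_split_of_mod_three_eq_one`;
* RAMIFIED: `asIdeal_eq_of_three_mem` (the only prime above `3` is `(λ)`, `3 = −ζ²λ²`);
* `asIdeal_eq_span_of_prime_mem` (a prime of the Dedekind domain containing a prime element is the
  ideal it generates).

## References

* K. Ireland, M. Rosen, *A Classical Introduction to Modern Number Theory*, 2nd ed., GTM 84 (1990),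
  Ch. 9 §1 Prop. 9.1.4. [cite: IrelandRosen1990, Prop. 9.1.4]

## Mathlib / tree search

Tree: `EisensteinFieldIntegers` (`mkInt`, `exists_eq_mkInt`, `mkInt_mul`, `mkInt_inj`, `norm_mk`,
`norm_int_mul`, `norm_int_pos`, `isUnit_mkInt_of_norm_eq_one`, `intCast_dvd_mkInt_iff`,
`prime_intCast_of_norm_ne`, `exists_coe_unit_eq`, `zetaInt_eq`, `prime_lamInt`,
`three_eq_neg_zetaInt_sq_mul_lamInt_sq`). Mathlib: `Prime.not_isSquare`, `exists_prime_orderOf_dvd_card` (Cauchy),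
`ZMod.card_units`, `ZMod.intCast_zmod_eq_zero_iff_dvd`, `WfDvdMonoid.exists_irreducible_factor`,
`UniqueFactorizationMonoid.irreducible_iff_prime`, `dvd_prime_pow`, `Int.eq_of_associated_of_nonneg`,
`Ideal.span_singleton_prime`, `Ideal.IsPrime.isMaximal`, `Ideal.IsMaximal.eq_of_le`,
`Ideal.span_singleton_eq_span_singleton`, `Algebra.coe_norm_int`. `lean search` for the splitting of
primes in `ℤ[ω]` (`mod_three_eq_one.*norm|split.*Eisenstein`): nothing beyond the inert criterion.
-/

noncomputable section

open NumberField QuadraticAlgebra IsDedekindDomain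

namespace Literature.NumberTheory.NumberFields

namespace K3

/-! ### Conjugates and the norm in coordinates -/

/-- The conjugate of `a + bζ` is `(a − b) − bζ`, and their product is the norm. [folklore] -/
theorem mkInt_mul_conj (a b : ℤ) : mkInt a b * mkInt (a - b) (-b) = ((a ^ 2 - a * b + b ^ 2 : ℤ) : 𝓞 K3) := by
  rw [mkInt_mul, ← mkInt_intCast]; congr 1 <;> ring

/-- **The algebra norm of `a + bζ` is `a² − ab + b²`.** [cite: IrelandRosen1990, Ch. 9 §1] -/
theorem algebraNorm_mkInt (a b : ℤ) : Algebra.norm ℤ (mkInt a b) = a ^ 2 - a * b + b ^ 2 := by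
  have h2 : Algebra.norm ℚ (⟨a, b⟩ : K3) = QuadraticAlgebra.norm (⟨a, b⟩ : K3) := by
    rw [Algebra.norm_apply, ← QuadraticAlgebra.det_toLinearMap_eq_norm]; congr 1
  have h3 : ((Algebra.norm ℤ (mkInt a b) : ℤ) : ℚ) = ((a ^ 2 - a * b + b ^ 2 : ℤ) : ℚ) := by
    rw [Algebra.coe_norm_int, show ((mkInt a b : 𝓞 K3) : K3) = ⟨a, b⟩ from rfl, h2, norm_mk]
    push_cast; ring
  exact_mod_cast h3

/-- **`N(span{a + bζ}) = a² − ab + b²`** (as a natural number). [folklore] -/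
theorem absNorm_span_mkInt (a b : ℤ) : Ideal.absNorm (Ideal.span {mkInt a b}) = (a ^ 2 - a * b + b ^ 2).natAbs := by
  rw [Ideal.absNorm_span_singleton, algebraNorm_mkInt]

/-- A unit has norm `1`. [folklore] -/
theorem norm_eq_one_of_isUnit {a b : ℤ} (h : IsUnit (mkInt a b)) : a ^ 2 - a * b + b ^ 2 = 1 := by
  obtain ⟨c, hc⟩ := h.exists_right_inv
  obtain ⟨x, y, rfl⟩ := exists_eq_mkInt c
  have hN : (a ^ 2 - a * b + b ^ 2) * (x ^ 2 - x * y + y ^ 2) = 1 := by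
    rw [mkInt_mul, ← mkInt_intCast 1 |>.trans Int.cast_one, mkInt_inj] at hc
    obtain ⟨h1, h2⟩ := hc
    rw [← norm_int_mul, h1, h2]; ring
  have h0 : ¬ (a = 0 ∧ b = 0) := by rintro ⟨rfl, rfl⟩; simp at hN
  exact Int.eq_one_of_mul_eq_one_right (norm_int_pos h0).le hN

/-- **An element of prime norm is prime.** [cite: IrelandRosen1990, Prop. 9.1.4] -/
theorem prime_mkInt_of_norm_eq_prime {a b : ℤ} {p : ℕ} (hp : p.Prime) (h : a ^ 2 - a * b + b ^ 2 = p) :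
    Prime (mkInt a b) := by
  refine (UniqueFactorizationMonoid.irreducible_iff_prime).mp ⟨?_, ?_⟩
  · intro hu
    have := norm_eq_one_of_isUnit hu
    rw [h] at this
    exact hp.ne_one (by exact_mod_cast this)
  · intro x y hxy
    obtain ⟨c, d, rfl⟩ := exists_eq_mkInt x
    obtain ⟨e, f, rfl⟩ := exists_eq_mkInt y
    have hN : (p : ℤ) = (c ^ 2 - c * d + d ^ 2) * (e ^ 2 - e * f + f ^ 2) := by
      rw [mkInt_mul, mkInt_inj] at hxy
      obtain ⟨h1, h2⟩ := hxy
      rw [← norm_int_mul, ← h1, ← h2, h]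
    have hx0 : ¬ (c = 0 ∧ d = 0) := by
      rintro ⟨rfl, rfl⟩; simp at hN; exact hp.ne_zero (by exact_mod_cast hN)
    have hy0 : ¬ (e = 0 ∧ f = 0) := by
      rintro ⟨rfl, rfl⟩; simp at hN; exact hp.ne_zero (by exact_mod_cast hN)
    have hxpos := norm_int_pos hx0
    have hypos := norm_int_pos hy0
    have hprime : Prime (p : ℤ) := Nat.prime_iff_prime_int.mp hp
    have hdvd : (c ^ 2 - c * d + d ^ 2) ∣ (p : ℤ) ^ 1 := by rw [pow_one]; exact Dvd.intro _ hN.symm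
    obtain ⟨i, hi, hassoc⟩ := (dvd_prime_pow hprime 1).mp hdvd
    have habs := Int.eq_of_associated_of_nonneg hassoc hxpos.le (by positivity)
    interval_cases i
    · left; exact isUnit_mkInt_of_norm_eq_one (by simpa using habs)
    · right
      rw [pow_one] at habs
      rw [habs] at hN
      have h1 : e ^ 2 - e * f + f ^ 2 = 1 := by
        have : (p : ℤ) * (e ^ 2 - e * f + f ^ 2 - 1) = 0 := by linear_combination -hN
        rcases mul_eq_zero.mp this with h' | h'
        · exact absurd h' (by exact_mod_cast hp.ne_zero)
        · linear_combination h'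
      exact isUnit_mkInt_of_norm_eq_one h1

/-! ### Inert primes `p ≡ 2 (mod 3)` -/

/-- The norm form is a square modulo `3`: `a² − ab + b² ≢ 2 (mod 3)` (`4N = (2a − b)² + 3b²`).
[cite: IrelandRosen1990, Prop. 9.1.4] -/
theorem norm_int_emod_three_ne_two (a b : ℤ) : (a ^ 2 - a * b + b ^ 2) % 3 ≠ 2 := by
  have h : (a ^ 2 - a * b + b ^ 2) % 3 = ((2 * a - b) ^ 2) % 3 := by
    have e : (2 * a - b) ^ 2 = (a ^ 2 - a * b + b ^ 2) + 3 * (a ^ 2 - a * b) := by ring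
    rw [e, Int.add_mul_emod_self_left]
  rw [h]
  have hsq : ∀ t : ℤ, t ^ 2 % 3 ≠ 2 := by
    intro t
    rcases Int.emod_emod_of_dvd t (by norm_num : (3 : ℤ) ∣ 3) with -
    have ht : t % 3 = 0 ∨ t % 3 = 1 ∨ t % 3 = 2 := by omega
    rcases ht with ht | ht | ht <;>
      · rw [pow_two, Int.mul_emod, ht]; norm_num
  exact hsq _

/-- **A rational prime `p ≡ 2 (mod 3)` is prime (inert) in `𝓞 ℚ(ζ₃)`.** [cite: IrelandRosen1990, Prop. 9.1.4] -/
theorem prime_natCast_of_mod_three_eq_two {p : ℕ} (hp : p.Prime) (hp3 : p % 3 = 2) :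
    Prime ((p : ℤ) : 𝓞 K3) :=
  prime_intCast_of_norm_ne hp fun a b h ↦ by
    have := norm_int_emod_three_ne_two a b
    rw [h] at this
    exact this (by omega)

/-! ### Split primes `p ≡ 1 (mod 3)` -/

/-- A prime `p ≡ 1 (mod 3)` has a non-trivial cube root of unity: `p ∣ x² + x + 1` for some `x`.
[cite: IrelandRosen1990, Prop. 9.1.4] -/
theorem exists_dvd_sq_add_self_add_one {p : ℕ} (hp : p.Prime) (hp3 : p % 3 = 1) :
    ∃ x : ℤ, (p : ℤ) ∣ x ^ 2 + x + 1 := by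
  haveI : Fact p.Prime := ⟨hp⟩
  have h3 : 3 ∣ Fintype.card (ZMod p)ˣ := by
    rw [ZMod.card_units p]
    exact (Nat.modEq_iff_dvd' hp.one_lt.le).mp (by rw [Nat.ModEq, hp3])
  obtain ⟨g, hg⟩ := exists_prime_orderOf_dvd_card 3 h3
  set y : ZMod p := (g : ZMod p) with hy
  have hy3 : y ^ 3 = 1 := by
    rw [hy, ← Units.val_pow_eq_pow_val, ← hg, pow_orderOf_eq_one, Units.val_one]
  have hy1 : y ≠ 1 := by
    intro h1
    have : g = 1 := Units.ext (by rw [← hy, h1, Units.val_one])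
    rw [this, orderOf_one] at hg
    norm_num at hg
  have hq : y ^ 2 + y + 1 = 0 := by
    have e : (y - 1) * (y ^ 2 + y + 1) = y ^ 3 - 1 := by ring
    rw [hy3, sub_self] at e
    exact (mul_eq_zero.mp e).resolve_left (sub_ne_zero.mpr hy1)
  refine ⟨(y.val : ℤ), ?_⟩
  rw [← ZMod.intCast_zmod_eq_zero_iff_dvd]
  push_cast
  rw [ZMod.natCast_zmod_val]
  exact hq

/-- `p ≡ 1 (mod 3)` is NOT prime in `𝓞 ℚ(ζ₃)` (`p ∣ (x − ζ)(x − ζ̄) = x² + x + 1` but `p ∤ x − ζ`).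
[cite: IrelandRosen1990, Prop. 9.1.4] -/
theorem not_prime_natCast_of_mod_three_eq_one {p : ℕ} (hp : p.Prime) (hp3 : p % 3 = 1) :
    ¬ Prime ((p : ℤ) : 𝓞 K3) := by
  obtain ⟨x, hx⟩ := exists_dvd_sq_add_self_add_one hp hp3
  intro hP
  -- `α = x − ζ = mkInt x (-1)` has norm `x² + x + 1`
  have hαβ : mkInt x (-1) * mkInt (x - -1) (- -1) = ((x ^ 2 + x + 1 : ℤ) : 𝓞 K3) := by
    rw [mkInt_mul_conj]; congr 1; ring
  have hdvd : ((p : ℤ) : 𝓞 K3) ∣ mkInt x (-1) * mkInt (x - -1) (- -1) := by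
    rw [hαβ]; exact map_dvd (Int.castRingHom (𝓞 K3)) hx
  rcases hP.dvd_or_dvd hdvd with h | h
  · rw [intCast_dvd_mkInt_iff] at h
    have := h.2
    have h1 : (p : ℤ) ∣ 1 := by simpa using this
    exact hp.ne_one (by exact_mod_cast Int.eq_one_of_dvd_one (by positivity) h1)
  · rw [intCast_dvd_mkInt_iff] at h
    have h1 : (p : ℤ) ∣ 1 := by simpa using h.2
    exact hp.ne_one (by exact_mod_cast Int.eq_one_of_dvd_one (by positivity) h1)

/-- **A prime `p ≡ 1 (mod 3)` is a norm: `p = a² − ab + b²`.** [cite: IrelandRosen1990, Prop. 9.1.4] -/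
theorem exists_norm_eq_of_mod_three_eq_one {p : ℕ} (hp : p.Prime) (hp3 : p % 3 = 1) :
    ∃ a b : ℤ, a ^ 2 - a * b + b ^ 2 = p := by
  have hp0 : ((p : ℤ) : 𝓞 K3) ≠ 0 := by
    rw [← mkInt_intCast, Ne, mkInt_eq_zero_iff]; simp [hp.ne_zero]
  have hpu : ¬ IsUnit ((p : ℤ) : 𝓞 K3) := by
    rw [← mkInt_intCast]
    intro hu
    have h1 := norm_eq_one_of_isUnit hu
    have h2 : (2 : ℤ) ≤ p := by exact_mod_cast hp.two_le
    nlinarith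
  obtain ⟨q, hqirr, hqdvd⟩ := WfDvdMonoid.exists_irreducible_factor hpu hp0
  obtain ⟨a, b, rfl⟩ := exists_eq_mkInt q
  obtain ⟨c, hc⟩ := hqdvd
  obtain ⟨e, f, rfl⟩ := exists_eq_mkInt c
  -- norms: `p² = N(q) N(c)`
  have hN : ((p : ℤ) ^ 2 : ℤ) = (a ^ 2 - a * b + b ^ 2) * (e ^ 2 - e * f + f ^ 2) := by
    rw [mkInt_mul, ← mkInt_intCast, mkInt_inj] at hc
    obtain ⟨h1, h2⟩ := hc
    rw [← norm_int_mul, ← h1, ← h2]; ring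
  have hq0 : ¬ (a = 0 ∧ b = 0) := by rintro ⟨rfl, rfl⟩; simp at hN; exact hp.ne_zero hN
  have hc0 : ¬ (e = 0 ∧ f = 0) := by rintro ⟨rfl, rfl⟩; simp at hN; exact hp.ne_zero hN
  have hqpos := norm_int_pos hq0
  have hcpos := norm_int_pos hc0
  have hprime : Prime (p : ℤ) := Nat.prime_iff_prime_int.mp hp
  have hdvd : (a ^ 2 - a * b + b ^ 2) ∣ (p : ℤ) ^ 2 := Dvd.intro _ hN.symm
  rcases (dvd_prime_pow hprime 2).mp hdvd with ⟨i, hi, hassoc⟩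
  have habs := Int.eq_of_associated_of_nonneg hassoc hqpos.le (by positivity)
  interval_cases i
  · -- `N(q) = 1`: `q` would be a unit
    exact absurd (isUnit_mkInt_of_norm_eq_one (by simpa using habs)) hqirr.not_isUnit
  · exact ⟨a, b, by simpa using habs⟩
  · -- `N(q) = p²`: then `c` is a unit and `p ~ q` is irreducible, hence prime: contradiction
    exfalso
    rw [habs] at hN
    have h1 : e ^ 2 - e * f + f ^ 2 = 1 := by
      have : (p : ℤ) ^ 2 * (e ^ 2 - e * f + f ^ 2 - 1) = 0 := by linear_combination -hN
      rcases mul_eq_zero.mp this with h | h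
      · exact absurd (pow_eq_zero_iff two_ne_zero |>.mp h) (by exact_mod_cast hp.ne_zero)
      · linear_combination h
    have hcu : IsUnit (mkInt e f) := isUnit_mkInt_of_norm_eq_one h1
    have hassocpq : Associated (mkInt a b) ((p : ℤ) : 𝓞 K3) := ⟨hcu.unit, by rw [IsUnit.unit_spec, hc]⟩
    have hpirr : Irreducible ((p : ℤ) : 𝓞 K3) := hassocpq.irreducible hqirr
    exact not_prime_natCast_of_mod_three_eq_one hp hp3
      (UniqueFactorizationMonoid.irreducible_iff_prime.mp hpirr)

/-- `3a² ≠ p` for a prime `p ≡ 1 (mod 3)`. [folklore] -/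
theorem three_mul_sq_ne {p : ℕ} (hp : p.Prime) (hp3 : p % 3 = 1) (a : ℤ) : 3 * a ^ 2 ≠ p := by
  intro h
  have h3 : (3 : ℤ) ∣ p := ⟨a ^ 2, h.symm⟩
  have h3' : 3 ∣ p := by exact_mod_cast h3
  have := (Nat.dvd_prime hp).mp h3'
  omega

/-- Units of `𝓞 K3` as algebraic integers: `u = ± ζ^i`. [cite: IrelandRosen1990, Prop. 9.1.3] -/
theorem exists_unit_eq_mkInt (u : (𝓞 K3)ˣ) :
    ∃ (s : ℤ) (i : ℕ), (s = 1 ∨ s = -1) ∧ i < 3 ∧ (u : 𝓞 K3) = s * zetaInt ^ i := by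
  obtain ⟨s, i, hs, hi, h⟩ := exists_coe_unit_eq u
  refine ⟨s, i, hs, hi, RingOfIntegers.ext ?_⟩
  rw [h]; rfl

/-- Negation in coordinates. [folklore] -/
theorem neg_mkInt (a b : ℤ) : -mkInt a b = mkInt (-a) (-b) := by
  have h : mkInt (-a) (-b) + mkInt a b = 0 := by
    rw [mkInt_add, mkInt_eq_zero_iff]; constructor <;> ring
  exact (eq_neg_of_add_eq_zero_left h).symm

/-- **The conjugate of a split prime is not associated to it** (`p ≡ 1 (mod 3)`, `N(ϖ) = p`):
otherwise `p` would be a square or `3·`square. [cite: IrelandRosen1990, Prop. 9.1.4] -/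
theorem not_associated_conj {a b : ℤ} {p : ℕ} (hp : p.Prime) (hp3 : p % 3 = 1)
    (h : a ^ 2 - a * b + b ^ 2 = p) : ¬ Associated (mkInt a b) (mkInt (a - b) (-b)) := by
  rintro ⟨u, hu⟩
  obtain ⟨s, i, hs, hi, hueq⟩ := exists_unit_eq_mkInt u
  rw [hueq, zetaInt_eq] at hu
  have hsq : ∀ a : ℤ, a ^ 2 ≠ p := fun a h ↦
    (Nat.prime_iff_prime_int.mp hp).not_isSquare ⟨a, by rw [← h, sq]⟩
  have h3sq := three_mul_sq_ne hp hp3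
  interval_cases i <;> rcases hs with rfl | rfl <;>
    simp only [pow_zero, pow_one, pow_two, mul_one, Int.cast_one, Int.cast_neg, one_mul, neg_mul,
      mkInt_mul, mul_neg, neg_mkInt, mkInt_inj] at hu <;> obtain ⟨e1, e2⟩ := hu
  all_goals try norm_num at e1 e2
  all_goals
    first
    | (have hb : b = 0 := (by linarith); subst hb; exact hsq a (by linear_combination h))
    | (have hb : b = 2 * a := (by linarith); subst hb; exact h3sq a (by linear_combination h))
    | (have ha : a = 0 := (by linarith); subst ha; exact hsq b (by linear_combination h))
    | (have ha : a = 2 * b := (by linarith); subst ha; exact h3sq b (by linear_combination h))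
    | (have ha : a = b := (by linarith); subst ha; exact hsq a (by linear_combination h))
    | (have ha : a = -b := (by linarith); subst ha; exact h3sq b (by linear_combination h))

/-- **`(p) = (ϖ)(ϖ̄)`** for `N(ϖ) = p`. [cite: IrelandRosen1990, Prop. 9.1.4] -/
theorem span_natCast_eq_mul_conj {a b : ℤ} {p : ℕ} (h : a ^ 2 - a * b + b ^ 2 = p) :
    Ideal.span {((p : ℤ) : 𝓞 K3)} = Ideal.span {mkInt a b} * Ideal.span {mkInt (a - b) (-b)} := by
  rw [Ideal.span_singleton_mul_span_singleton, mkInt_mul_conj, h]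

/-- The two primes above a split `p` are distinct ideals. [cite: IrelandRosen1990, Prop. 9.1.4] -/
theorem span_ne_span_conj {a b : ℤ} {p : ℕ} (hp : p.Prime) (hp3 : p % 3 = 1)
    (h : a ^ 2 - a * b + b ^ 2 = p) : Ideal.span {mkInt a b} ≠ Ideal.span {mkInt (a - b) (-b)} := by
  rw [Ne, Ideal.span_singleton_eq_span_singleton]
  exact not_associated_conj hp hp3 h

/-- The conjugate has the same norm. [folklore] -/
theorem norm_conj_eq (a b : ℤ) : (a - b) ^ 2 - (a - b) * (-b) + (-b) ^ 2 = a ^ 2 - a * b + b ^ 2 := by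
  ring

/-! ### The primes of `𝓞 K3` above a rational prime -/

/-- A prime of `𝓞 K3` containing a prime ELEMENT `q` is `(q)`. [folklore] -/
theorem asIdeal_eq_span_of_prime_mem {q : 𝓞 K3} (hq : Prime q) (v : HeightOneSpectrum (𝓞 K3))
    (h : q ∈ v.asIdeal) : v.asIdeal = Ideal.span {q} := by
  have hprime : (Ideal.span {q}).IsPrime := (Ideal.span_singleton_prime hq.ne_zero).mpr hq
  have hmax : (Ideal.span {q}).IsMaximal :=
    hprime.isMaximal (by rw [Ne, Ideal.span_singleton_eq_bot]; exact hq.ne_zero)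
  exact (hmax.eq_of_le v.isPrime.ne_top ((Ideal.span_singleton_le_iff_mem _).mpr h)).symm

/-- **Inert case**: the only prime above `p ≡ 2 (mod 3)` is `(p)`. [cite: IrelandRosen1990, Prop. 9.1.4] -/
theorem asIdeal_eq_of_mod_three_eq_two {p : ℕ} (hp : p.Prime) (hp3 : p % 3 = 2)
    (v : HeightOneSpectrum (𝓞 K3)) (h : ((p : ℤ) : 𝓞 K3) ∈ v.asIdeal) :
    v.asIdeal = Ideal.span {((p : ℤ) : 𝓞 K3)} :=
  asIdeal_eq_span_of_prime_mem (prime_natCast_of_mod_three_eq_two hp hp3) v h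

/-- **Split case**: a prime above `p = N(ϖ)`, `ϖ = a + bζ`, is `(ϖ)` or `(ϖ̄)`.
[cite: IrelandRosen1990, Prop. 9.1.4] -/
theorem asIdeal_eq_or_of_norm_eq {a b : ℤ} {p : ℕ} (hp : p.Prime) (h : a ^ 2 - a * b + b ^ 2 = p)
    (v : HeightOneSpectrum (𝓞 K3)) (hv : ((p : ℤ) : 𝓞 K3) ∈ v.asIdeal) :
    v.asIdeal = Ideal.span {mkInt a b} ∨ v.asIdeal = Ideal.span {mkInt (a - b) (-b)} := by
  have hmem : mkInt a b * mkInt (a - b) (-b) ∈ v.asIdeal := by rwa [mkInt_mul_conj, h]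
  rcases v.isPrime.mem_or_mem hmem with h1 | h1
  · exact Or.inl (asIdeal_eq_span_of_prime_mem (prime_mkInt_of_norm_eq_prime hp h) v h1)
  · exact Or.inr (asIdeal_eq_span_of_prime_mem
      (prime_mkInt_of_norm_eq_prime hp ((norm_conj_eq a b).trans h)) v h1)

/-- **Ramified case**: the only prime above `3` is `(λ)`. [cite: IrelandRosen1990, Prop. 9.1.4] -/
theorem asIdeal_eq_of_three_mem (v : HeightOneSpectrum (𝓞 K3)) (h : (3 : 𝓞 K3) ∈ v.asIdeal) :
    v.asIdeal = Ideal.span {lamInt} := by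
  refine asIdeal_eq_span_of_prime_mem prime_lamInt v ?_
  rw [three_eq_neg_zetaInt_sq_mul_lamInt_sq, Ideal.neg_mem_iff] at h
  rcases v.isPrime.mem_or_mem h with h1 | h1
  · exfalso
    have hu : IsUnit (zetaInt ^ 2 : 𝓞 K3) :=
      (isPrimitiveRoot_zeta.toInteger_isPrimitiveRoot.isUnit (by norm_num)).pow 2
    exact v.isPrime.ne_top (Ideal.eq_top_of_isUnit_mem _ h1 hu)
  · exact (v.isPrime.mem_or_mem (by rwa [sq] at h1)).elim id id

/-- **Summary for a split prime**: for `p ≡ 1 (mod 3)` there are `a, b` with `N(a + bζ) = p`,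
`a + bζ` and its conjugate are non-associated primes, `(p) = (ϖ)(ϖ̄)`, and every prime above `p`
is one of the two. [cite: IrelandRosen1990, Prop. 9.1.4] -/
theorem exists_split_of_mod_three_eq_one {p : ℕ} (hp : p.Prime) (hp3 : p % 3 = 1) :
    ∃ a b : ℤ, a ^ 2 - a * b + b ^ 2 = p ∧ Prime (mkInt a b) ∧ Prime (mkInt (a - b) (-b)) ∧
      Ideal.span {mkInt a b} ≠ Ideal.span {mkInt (a - b) (-b)} ∧
      Ideal.span {((p : ℤ) : 𝓞 K3)} = Ideal.span {mkInt a b} * Ideal.span {mkInt (a - b) (-b)} := by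
  obtain ⟨a, b, h⟩ := exists_norm_eq_of_mod_three_eq_one hp hp3
  exact ⟨a, b, h, prime_mkInt_of_norm_eq_prime hp h,
    prime_mkInt_of_norm_eq_prime hp ((norm_conj_eq a b).trans h), span_ne_span_conj hp hp3 h,
    span_natCast_eq_mul_conj h⟩

end K3

end Literature.NumberTheory.NumberFields

end
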